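import Summits.CriticalPhenomena.PercolationContinuityZ3.Theorems.Transplant.SkelNegBParamsResiduals
import Summits.CriticalPhenomena.PercolationContinuityZ3.Theorems.Transplant.SkelPhiNegReachRecs
import HarnessLib

/-!
# N1 params, chain of record `NegB`, part ReachEx: THE (C) SLOT HYPOTHESIS `hex` OF `reachHoldsRHNOFn_negChoiceAllOT` (p5-g9, p305159) DISCHARGED AT `exR`
# (kit index of record `mk := 0`): `r₀A (R (pgScale n_L h_L 3ℓ_L)) + 3 ≤ exR` and `4 + 13·(800·(n_L + Q_w)) ≤ exR`

builds on p205010 (kernel theorem, internal audit signed; external expert review pending) — nothing in this file uses p205010; NOTHING is claimed about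
the node `SamePDropOfSkeletonNeg₁` (OPEN).
Lane `prim-bschramm-*`, seat `prim-bschramm-stmt` (gen 14); helper file (`--supports stmt-CriticalPhenomena-4575 --as helper`); ledger HOME/prim-bschramm-stmt/NEG-PARAMS.md v0.13.
[cite: KozmaNitzan2024, §4 Theorem 6 (pp. 25–31): the order of constants]
-/

noncomputable section

open scoped Classical

namespace Summit.CriticalPhenomena.PercolationContinuityZ3.Theorems.Transplant

namespace PlanarSkeletonNeg

namespace NegB

open Literature.Probability.Percolation Literature.Probability.LatticeModels SimpleGraph
open SkelConc (Consts)
open Skelφ.StepI (DataN)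
open Neg

/-- **p5-g9's `hex` at `ex := exR`, `mk := 0`** (both conjuncts are summands of `exR`; `CorrRec.Qw n_L ℓ_L h_L = KS.Wrun`). [folklore] -/
theorem hex_exR (gx fx : Neg.FSlot) :
    ∀ (κ : Consts) {V : Type} [DecidableEq V] [Countable V] {G : SimpleGraph V} [G.LocallyFinite] (Φ : PlanarSkeletonNeg G) (t : V) (p : unitInterval) (D : DataN V),
      KS.r₀A Φ t D 0 (D.R (D.scale t (ML κ Φ t p D (KS.gT 0 gx κ Φ t p D)) (nL κ Φ t p D (KS.gT 0 gx κ Φ t p D) (KS.fT 0 fx κ Φ t p D)))) + 3 ≤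
          exR κ Φ t p D (KS.gT 0 gx κ Φ t p D) (KS.fT 0 fx κ Φ t p D) ∧
        4 + 13 * (800 * (nL κ Φ t p D (KS.gT 0 gx κ Φ t p D) (KS.fT 0 fx κ Φ t p D) +
          Skelφ.CorrRec.Qw (nL κ Φ t p D (KS.gT 0 gx κ Φ t p D) (KS.fT 0 fx κ Φ t p D)) (ℓL κ Φ t p D (KS.gT 0 gx κ Φ t p D) (KS.fT 0 fx κ Φ t p D))
            (hL κ Φ t p D (KS.gT 0 gx κ Φ t p D) (KS.fT 0 fx κ Φ t p D)))) ≤ exR κ Φ t p D (KS.gT 0 gx κ Φ t p D) (KS.fT 0 fx κ Φ t p D) := by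
  intro κ V _ _ G _ Φ t p D
  show KS.r₀A Φ t D 0 (Rl κ Φ t p D _ _) + 3 ≤ _ ∧ 4 + 13 * (800 * (nL κ Φ t p D _ _ + KS.Wrun κ Φ t p D _ _)) ≤ _
  unfold exR exC
  constructor <;> omega

/-- The same for arbitrary `(g, f)` (the floors are summands of `exR κ Φ t p D g f` for every `g, f`). [folklore] -/
theorem hex_exR_at (κ : Consts) {V : Type} [DecidableEq V] [Countable V] {G : SimpleGraph V} [G.LocallyFinite] (Φ : PlanarSkeletonNeg G) (t : V) (p : unitInterval)
    (D : DataN V) (g f : ℕ) :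
    KS.r₀A Φ t D 0 (D.R (D.scale t (ML κ Φ t p D g) (nL κ Φ t p D g f))) + 3 ≤ exR κ Φ t p D g f ∧
      4 + 13 * (800 * (nL κ Φ t p D g f + Skelφ.CorrRec.Qw (nL κ Φ t p D g f) (ℓL κ Φ t p D g f) (hL κ Φ t p D g f))) ≤ exR κ Φ t p D g f := by
  show KS.r₀A Φ t D 0 (Rl κ Φ t p D g f) + 3 ≤ _ ∧ 4 + 13 * (800 * (nL κ Φ t p D g f + KS.Wrun κ Φ t p D g f)) ≤ _
  unfold exR exC
  constructor <;> omega

end NegB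

end PlanarSkeletonNeg

end Summit.CriticalPhenomena.PercolationContinuityZ3.Theorems.Transplant
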